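import Literature.Claims.NS.ClayR3L3Bridge
import Literature.Analysis.FluidPDE.SuitableWeak
import Literature.Claims.NS.ClayR3LocalEnergyBridge
import Literature.Analysis.FluidPDE.ClayDataSobolev
import Mathlib.MeasureTheory.Integral.Average
import HarnessLib

/-!
# Claim skeleton (D-0090 NS-CLAIMS, C165): Dahlke, «Global Regularity for 3D Navier–Stokes via Critical
# Budgets and Rigidity» (Zenodo 18905486 = v10, 2026-03-07, 73 pp.)

Typed CHAIN-LEVEL skeleton of Björn E. Dahlke, *Global Regularity for 3D Navier–Stokes via Critical
Budgets and Rigidity*, Zenodo record **18905486** (= v10, `is_last` of concept 17168105; file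
`NavierStokes_v10.pdf`, PDF sha16 `223a8322a1ec26fc`, 73 pp.; PDF page = printed page = file
`pages/pNNN.txt` of the census pin `run/shared/lean/pub/ns-claims/census/texts/Dahlke2026/`) = bib
`Dahlke2026` = TEXT OF RECORD of cell `ns-claims` row C165 (chair's choice, RULINGS v1.41, lead-1 g6
2026-08-27T14:00:58Z; tail tranche 4e, census annex §B, «T2 FULL CLAIM»); «p.N l.M» = line M of
`pages/pNNN.txt`; lit seat's `sources/Dahlke2026/LOCATORS.md` (ns-claims-lit-1 g10, cb84ee2122cbde98).
UNREFEREED CLAIM under adjudication — NOTHING in this file asserts a step of the paper: the printed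
statements are `def … : Prop`; the `theorem`s are the kernel composition of the paper's OWN implications
and the Clay (A) link (the Escauriaza–Seregin–Šverák endpoint step, Thm 11.5, is a THEOREM of the tree:
`ClayVariants.clayR3_regularityAt_iff_aprioriL3Bound`). Typist `ns-claims-typist-6` g6; CARD
`claims/Dahlke2026/CARD.md` (PREDICTION sealed 2026-08-27T14:07:58Z, sha16 `a9460ec338443cc5`, written
from RULINGS v1.41 + p.1 + p.14 only). Verdict vocabulary is the refuter's / referee's.

## The claimed statement, as printed (Theorem 3.1, p.14 l.34–51)
«Theorem 3.1 (Main global regularity and uniqueness). For every smooth divergence-free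
u0 ∈ L²(ℝ³) ∩ Ḣ^{1/2}(ℝ³) there exists a unique global suitable solution (u, p) of the incompressible
Navier–Stokes system on ℝ³ × [0, ∞) satisfying p, u ∈ C∞(ℝ³ × [0, ∞)), and such that (i) u ∈
C∞(ℝ³ × [0, ∞)), in particular smooth up to and including t = 0; (ii) the global energy equality holds
for all 0 ≤ t1 < t2 < ∞; (iii) u is unique in the Leray class among suitable weak solutions with the
same initial data; (iv) the periodic case on T³ satisfies the same conclusions. Consequently the Clay
alternative (A) in the formulation of Fefferman [9] holds and the breakdown alternative (B) is
excluded.» Setting §1 (1.1) p.5: `∂ₜu − Δu + (u·∇)u + ∇p = 0`, `div u = 0` on ℝ³ (viscosity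
NORMALISED to 1); §3 p.14 l.4–6: «Throughout we work on ℝ³ with smooth divergence-free initial data in
the Schwartz class, as in the Clay formulation».

RENDERING (cell convention; `lean search` done, tree vocabulary REUSED BY NAME, nothing re-declared):
datum `IsDatum` := C^∞ ∧ divergence-free ∧ `HasRapidSpatialDecay` (Fefferman's (4) — EXACTLY the class
§3 p.14 l.4–6 fixes; Thm 3.1's printed face «smooth div-free u₀ ∈ L² ∩ Ḣ^{1/2}» is WIDER — the claim
is STRONGER than (A) on the data axis; recorded, no delta against the claimant); the solutions the
printed chain is consumed on (Thm 11.5 p.45 / the ESS door) = the finite-energy CLASSICAL class on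
half-open slabs `[0,T)` of `ClayR3L3Bridge` (`IsSol`: `IsClassicalNSSolutionOn (Ico 0 T) 1 0 u p`,
`u 0 = u₀`, a finite bound on `∫|u(t)|²`); the print states Thm 15.3 / 15.8 / 2.7 for SUITABLE WEAK
solutions with finite energy (§15.7 p.62 l.68–85) — a wider class containing this one, so every typed
step is an INSTANCE of the printed one (weaker, never stronger); conclusion (i) + bounded energy =
Clay-sense solvability `ClayVariants.clayR3.Solvable 1 0 u₀` ((6)(7) at ν = 1; all ν by the tree's
scaling `clayR3_regularityAt_iff`). (ii) energy equality, (iii) Leray-class uniqueness, (iv) T³ / Thm 8.1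
p.30 are EXTRAS beyond (A) — recorded, not typed (TRUE-column material given a global smooth solution
in the Prodi–Serrin class: Thms 5.1 / 6.3 / 7.1 / 7.5; LOCATORS §2).

## Clay delta (reference `Literature.Claims.NS.ClayVariants`; LOCATORS §2)
Nearest: (A) `clayR3.Regularity`. Δ1 domain ℝ³ = · Δ2 equations, ν normalised to 1 (Δ7 scaling,
`clayR3_regularityAt_iff`) · Δ3 force ≡ 0 = · Δ4 data: printed class WIDER than (4), §3 restricts to
Schwartz = (4) — typed (4) EXACTLY · Δ5 solution class (6)(7) ⊆ «C∞(ℝ³ × [0,∞))» + energy equality (ii)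
· Δ6 none · Δ8 none. `claimedTheorem_iff_clayA : ClaimedTheorem ↔ clayR3.Regularity` PROVED — no
«wrong problem» axis; the lanes adjudicate the printed chain.

## Step index = the printed chain (p.14 l.14–19, Remark 3.3 p.15 l.64–81, p.64 l.67–68, p.71
## l.49–50), in dependency order, at the grain Thm 3.1's proof CONSUMES it (RULINGS v1.41 HAZARDS:
## chain-level; Thm 15.3 in its PROVED printing p.63, Thm 2.1 p.8 recorded as the second printing)
* `Step_Thm153` — **P1 = Theorem 15.3 p.63 l.1–16** (budget three-cylinder (15.9) for EVERY centre
  z₀ ∈ ℝ³ × (0,T) and ALL radii 0 < ρ < R < r₀ with Q_{4R}(z₀) in the slab; constants depending on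
  (M, T); tail B(R) ≤ C_M (15.10)). Second printing Thm 2.1 p.8 l.62–66 («universal constants», local,
  tail B(u,p;2R) of (2.3)) RECORDED, not typed. Printed proof pp.67–71 via Lemma 15.10 (CKN ⇒ Morrey
  smallness on GOOD scales, (15.17) ⇒ (15.18)), Lemma 15.12 (solution-level three-cylinder UNDER the
  Morrey smallness (15.19)), Lemmas 15.13–15.16; Remark 15.11 p.68 l.13–14 «The proof of Theorem 15.3
  is organized on scales for which the larger cylinder Q_{4R}(z0) is good»; Remark 15.6 p.63 l.47–55
  «P1 is … a quantitative reformulation of the global regularity problem». Binder `h153`.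
* `Step_1511` — **(15.11) p.64 l.1–5**: «Theorem 15.3 implies that there exist constants C1 ≥ 1 and
  θ ∈ (0, 1) such that for all j ≥ j0+1, M_j ≤ C1 M_{j−1}^θ M_{j+1}^{1−θ} + C1 B» for the dyadic budget
  sups `M_j := sup_{z0 ∈ Q_{1/2}} K(r_j, z0)`, `r_j = 2^{−j}` (p.63 l.60–63) — typed AS the implication
  «Thm 15.3 ⟹ (15.11)» along every solution of the class and every region centre. Binder `h1511`.
* `Step_L157` — **Lemma 15.7 (Discrete convexity iteration) p.64 l.7–20 VERBATIM, at its printed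
  ABSTRACT grain** (a statement about arbitrary sequences of nonnegative reals; no NS vocabulary):
  «Let (X_j)_{j≥j0} be a sequence of nonnegative numbers and let C1 ≥ 1, θ ∈ (0, 1). Assume that for
  all integers j ≥ j0 + 1 we have X_j ≤ C1 X_{j−1}^θ X_{j+1}^{1−θ} + C1 B, (15.12) for some B ≥ 0. Then
  there exists a constant C2 = C2(C1, θ) such that sup_{j≥j0} X_j ≤ C2 (X_{j0} + B).» (§2 printing:
  Lemma 2.5 «Barrier» p.11 l.55–59 with (2.20)–(2.21), j ∈ ℤ, anchored by (2.19) — RECORDED.) CONSUMED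
  by Thm 15.8's proof p.64 l.67–76 «We apply Lemma 15.7 with X_j = M_j». Binder `h157`.
* `Step_Energy` — §15.7 p.62 l.68–85: the solutions carry a finite energy bound M
  («sup_{0<t<T} ∫|u|² + ∫₀ᵀ∫|∇u|² ≤ M²»). TRUE-type for the class typed here (energy equality of
  finite-energy classical solutions from Schwartz data); binder `hE`, not a candidate locator.
* `Step_L3_of_dyadic` — **Thm 15.8 p.64 l.83–89 + (2.22) p.12 l.13–17 + Proposition 2.6 (c) ⇒ (a)
  p.12 l.19–29 + Thm 2.7 p.13 l.85–94, AS CONSUMED p.14 l.56–60**: a (dyadic, every-region) bound on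
  the critical budgets along a solution of the class gives `u ∈ L∞((0,T); L³(ℝ³))`. Binder `hL3`.
* `Step_Thm27` — **Theorem 2.7 AS CONSUMED by Thm 3.1's proof p.14 l.56–60 / Thm 11.5 p.45 l.25–35**
  («By Theorem 2.7, for every T > 0 one has u ∈ L∞((0, T); L³(ℝ³))»): along every solution of the
  class, `sup_{t∈[0,T)} ‖u(t)‖_{L³} < ∞`. DERIVED in the kernel from the five binders above
  (`thm27_of_steps`); its printed Φ-uniform face (2.27)/l.85–87 RECORDED in the docstring.
* `Step_Thm115` — **Theorem 11.5 p.45 l.25–37** («Assume P1, i.e. Theorem 2.7. Then … By the endpoint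
  Prodi–Serrin criterion of Escauriaza–Seregin–Šverák … no finite blow-up time exists»): TRUE — PROVED
  (`step_Thm115_holds`, the tree's ESS door `clayR3_regularityAt_iff_aprioriL3Bound`).
* Compositions: `thm27_of_steps`, `claim_of_thm27`, **`claim_of_steps (h153) (h1511) (h157) (hE) (hL3) :
  ClaimedTheorem`** PROVED; `claimedTheorem_iff_clayA`, `clay_of_steps` PROVED.
Not typed (recorded): CKN Thm 1.1 p.6 (tree `ckn_epsilon_regularity_unforced`), Lemmas 15.9–15.16 and
§§4, 9–14 (the analytic route inside the proof of Thm 15.3 — below the chain grain), Thms 5.1 / 6.3 /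
7.1 / 7.5 / 8.1 and Cor 3.2 (extras (ii)–(iv)), §2.3 good–λ / Carleson (Lemma 2.3, Remark 2.4).
Convention: the tree's space–time points are `z = (t, x) : ℝ × ℝ³` (the print writes z0 = (x0, t0)).

WHAT THIS IS NOT: not a claim about NS regularity or blow-up; not a claim about any author beyond the
typed locator.
-/

open scoped ContDiff ENNReal NNReal Topology
open Set Filter MeasureTheory Function

namespace Literature.Claims.NS.Dahlke2026

open Literature.Analysis Literature.Analysis.FluidPDE Literature.Claims.NS.ClayVariants

noncomputable section

/-! ## Vocabulary -/

/-- `ℝ³`. [cite: Dahlke2026, §1 (1.1) p.5] -/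
abbrev E3 : Type := EuclideanSpace ℝ (Fin 3)

/-- **The data class on which §3 runs** (p.14 l.4–6 «smooth divergence-free initial data in the Schwartz
class, as in the Clay formulation»): C^∞, divergence-free, rapid decay of every derivative — Fefferman's
(4) EXACTLY. Thm 3.1's printed face «smooth divergence-free u0 ∈ L²(ℝ³) ∩ Ḣ^{1/2}(ℝ³)» (p.14 l.34–41)
is WIDER (recorded; TODO(general form): the L² ∩ Ḣ^{1/2} face via `ClayDataSobolev`).
[cite: Dahlke2026, §3 p.14 l.4–13; Thm 3.1 p.14 l.34–41] [cite: FeffermanClay2006, (4) p. 1] -/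
def IsDatum (u₀ : E3 → E3) : Prop :=
  ContDiff ℝ ∞ u₀ ∧ NSWave0.IsDivFree u₀ ∧ HasRapidSpatialDecay u₀

/-- **The solutions the chain is consumed on** (Thm 11.5 p.45 l.25–36, the ESS endpoint; the tree's
door `clayR3_regularityAt_iff_aprioriL3Bound`): a classical solution of the unforced system with
viscosity 1 (the print's normalisation (1.1) p.5) on the half-open slab `[0,T) × ℝ³` with `u(0) = u₀`
and a finite bound on the kinetic energy `∫|u(t)|²` over `[0,T)`. The print's own class is «suitable
weak solutions … with finite energy» (Def 15.1 p.61, §15.7 p.62 l.68–85) — WIDER; every statement below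
is the printed one INSTANTIATED on this sub-class. [cite: Dahlke2026, §15.7 p.62 l.68–85; Thm 11.5 p.45 l.25–36]
[cite: FeffermanClay2006, (6) (7) p. 2] -/
def IsSol (T : ℝ) (u₀ : E3 → E3) (u : ℝ → E3 → E3) (p : ℝ → E3 → ℝ) : Prop :=
  IsClassicalNSSolutionOn (Ico 0 T) 1 0 u p ∧ u 0 = u₀ ∧
    ∃ A : ℝ≥0∞, A < ⊤ ∧ ∀ t ∈ Ico 0 T, ∫⁻ x, ‖u t x‖ₑ ^ 2 ≤ A

/-- **The energy bound `M` of §15.7** (p.62 l.68–85): «sup_{0<t<T} ∫_{ℝ³} |u(x,t)|² dx +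
∫₀ᵀ ∫_{ℝ³} |∇u|² dx dt ≤ M²». [cite: Dahlke2026, §15.7 p.62 l.68–85] -/
def EnergyBound (M T : ℝ) (u : ℝ → E3 → E3) : Prop :=
  (⨆ t ∈ Ioo 0 T, ∫⁻ x, ‖u t x‖ₑ ^ 2) +
      (∫⁻ q in Ioo 0 T ×ˢ (univ : Set E3), ENNReal.ofReal (frobeniusNormSq (fderiv ℝ (u q.1) q.2))) ≤
    ENNReal.ofReal (M ^ 2)

/-- The open space–time slab `ℝ³ × (0,T)` in the tree's `(t, x)` order. [cite: Dahlke2026, §15.7 p.62 l.68–69] -/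
def slab (T : ℝ) : Set (ℝ × E3) := Ioo 0 T ×ˢ (univ : Set E3)

/-- **The pressure budget `D(p; r, z₀)` of (15.6) p.62 / p.12 l.57–69** with the MEAN-FREE pressure:
`D(p; r, z₀) = r⁻² ∫∫_{Q_r(z₀)} |p − (p)_{B_r(x₀)}(t)|^{3/2} dx dt` (the tree's `cknD` is the raw-`|p|^{3/2}`
variant of Lin 1998 — the print's mean-free version is typed here). `ℝ≥0∞`-valued; junk `∞·…` for
`r ≤ 0`, never used there. [cite: Dahlke2026, (15.6) p.62; Remark 15.4 p.63] -/
def budgetD (r : ℝ) (z : ℝ × E3) (p : ℝ → E3 → ℝ) : ℝ≥0∞ :=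
  (ENNReal.ofReal r ^ 2)⁻¹ *
    ∫⁻ q in parabolicCylinder r z, ‖p q.1 q.2 - ⨍ y in Metric.ball z.2 r, p q.1 y‖ₑ ^ (3 / 2 : ℝ)

/-- **The combined critical budget `K(r, z₀) := C(u; r, z₀) + D(p; r, z₀)`** (p.62 l.64–66), with the
tree's scale-invariant cubic quantity `cknC r z u = r⁻² ∫∫_{Q_r(z)} |u|³` ((15.5); CKN 1982 §2) and the
mean-free pressure budget `budgetD`. [cite: Dahlke2026, §15.6 p.62 l.64–66; (15.5)–(15.6) p.62] -/
def budgetK (r : ℝ) (z : ℝ × E3) (u : ℝ → E3 → E3) (p : ℝ → E3 → ℝ) : ℝ≥0∞ :=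
  cknC r z u + budgetD r z p

/-- **The dyadic budget sups of §15.8** (p.63 l.58–63): «We restrict to a fixed compact space–time region
and dyadic radii. For each dyadic radius r_j := 2^{−j} … we set M_j := sup_{z0 ∈ Q_{1/2}} K(r_j, z0)» —
here with the region `Q_{1/2}(z_c)` centred at an arbitrary space–time point `z_c` (the print leaves the
centre implicit). [cite: Dahlke2026, §15.8 p.63 l.58–63] -/
def dyadicSup (zc : ℝ × E3) (u : ℝ → E3 → E3) (p : ℝ → E3 → ℝ) (j : ℕ) : ℝ≥0∞ :=
  ⨆ z₀ ∈ parabolicCylinder (1 / 2 : ℝ) zc, budgetK ((2 : ℝ)⁻¹ ^ j) z₀ u p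

/-! ## The claimed statement (Theorem 3.1 p.14 l.34–51) -/

/-- **Theorem 3.1 (i) with (7), on the data class of §3**: every Clay datum launches a global solution
smooth on `ℝ³ × [0,∞)` with bounded energy — Clay-sense solvability at the print's normalised viscosity
`ν = 1` (`ClayVariants.clayR3.Solvable 1 0 u₀`: `u, p ∈ C^∞(ℝ³ × [0,∞))`, (1)–(3), (7)). Extras (ii)
energy equality, (iii) Leray-class uniqueness, (iv) T³ recorded in the module docstring, not typed.
[claim: Dahlke2026, status: under-review] [cite: Dahlke2026, Thm 3.1 p.14 l.34–51; §3 p.14 l.4–13] -/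
def ClaimedExistence : Prop :=
  ∀ u₀ : E3 → E3, IsDatum u₀ → clayR3.Solvable 1 0 u₀

/-- **CLAIMED THEOREM = Theorem 3.1 p.14 l.34–51, core (i) + (7) on the §3 data class** («Consequently the
Clay alternative (A) … holds»). [claim: Dahlke2026, status: under-review] [cite: Dahlke2026, Thm 3.1 p.14 l.34–51] -/
def ClaimedTheorem : Prop := ClaimedExistence

/-! ## The steps of the printed chain (no assertion) -/

/-- **Step P1 — Theorem 15.3 (Critical budget three cylinder principle (P1)) p.63 l.1–16, the PROVED
printing** (Thm 2.1 p.8 l.62–66 is the second printing, recorded): «Let T > 0 and M > 0. There exist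
constants C ≥ 1, θ ∈ (0, 1) and r0 ∈ (0, 1), depending only on M and T, such that the following holds.
Let (u, p) be a suitable weak solution of (15.1) on ℝ³ × (0, T) with energy bound M and let
z0 = (x0, t0) ∈ ℝ³ × (0, T). For all radii 0 < ρ < R < r0 with Q_{4R}(z0) ⊂ ℝ³ × (0, T) we have the
budget three cylinder inequality K(R, z0) ≤ C K(ρ, z0)^θ K(2R, z0)^{1−θ} + C B(R), (15.9) where B(R)
is a tail term that depends only on large scale norms of u and p … and satisfies B(R) ≤ C_M (15.10)
for all 0 < R < r0, with a constant C_M depending only on M and T.» Instantiated on the class `IsSol`.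
[claim: Dahlke2026, status: under-review] [cite: Dahlke2026, Thm 15.3 p.63 l.1–16; Thm 2.1 p.8 l.62–66] -/
def Step_Thm153 : Prop :=
  ∀ T : ℝ, 0 < T → ∀ M : ℝ, 0 < M →
    ∃ C θ r₀ CM : ℝ, 1 ≤ C ∧ 0 < θ ∧ θ < 1 ∧ 0 < r₀ ∧ r₀ < 1 ∧ 0 ≤ CM ∧
      ∀ (u₀ : E3 → E3) (u : ℝ → E3 → E3) (p : ℝ → E3 → ℝ),
        IsDatum u₀ → IsSol T u₀ u p → EnergyBound M T u →
          ∃ B : ℝ → ℝ, (∀ R : ℝ, 0 < R → R < r₀ → 0 ≤ B R ∧ B R ≤ CM) ∧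
            ∀ z₀ ∈ slab T, ∀ ρ R : ℝ, 0 < ρ → ρ < R → R < r₀ →
              parabolicCylinder (4 * R) z₀ ⊆ slab T →
                budgetK R z₀ u p ≤
                  ENNReal.ofReal C * budgetK ρ z₀ u p ^ θ * budgetK (2 * R) z₀ u p ^ (1 - θ) +
                    ENNReal.ofReal (C * B R)

/-- **Step (15.11) — p.64 l.1–5**: «Theorem 15.3 implies that there exist constants C1 ≥ 1 and
θ ∈ (0, 1) such that for all j ≥ j0+1, M_j ≤ C1 M_{j−1}^θ M_{j+1}^{1−θ} + C1 B, (15.11) where B ≥ 0 is a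
bound for the tail term B(r_j) coming from (15.10)» (with «j ≥ j0 large enough so that r_j ≤ r0»,
p.63 l.60) — typed AS THE PRINTED IMPLICATION from Theorem 15.3, along every solution of the class and
every region centre `z_c` in the slab, the dyadic sups being finite from `j0` on (so that the
inequality is between real numbers, as printed). [claim: Dahlke2026, status: under-review]
[cite: Dahlke2026, (15.11) p.64 l.1–5; §15.8 p.63 l.56–63] -/
def Step_1511 : Prop :=
  Step_Thm153 →
    ∀ T : ℝ, 0 < T → ∀ M : ℝ, 0 < M →
      ∀ (u₀ : E3 → E3) (u : ℝ → E3 → E3) (p : ℝ → E3 → ℝ),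
        IsDatum u₀ → IsSol T u₀ u p → EnergyBound M T u →
          ∀ zc ∈ slab T, ∃ C₁ θ B : ℝ, ∃ j₀ : ℕ, 1 ≤ C₁ ∧ 0 < θ ∧ θ < 1 ∧ 0 ≤ B ∧
            (∀ j : ℕ, j₀ ≤ j → dyadicSup zc u p j < ⊤) ∧
            ∀ j : ℕ, j₀ + 1 ≤ j →
              (dyadicSup zc u p j).toReal ≤
                C₁ * (dyadicSup zc u p (j - 1)).toReal ^ θ * (dyadicSup zc u p (j + 1)).toReal ^ (1 - θ) +
                  C₁ * B

/-- **Step L15.7 — Lemma 15.7 (Discrete convexity iteration) p.64 l.7–20, VERBATIM at its printed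
abstract grain** (TYPING-HYGIENE 13: a statement about arbitrary sequences of nonnegative real numbers,
indexed from `j0`; `C2 = C2(C1, θ)` depends on `C1, θ` only): «Let (X_j)_{j≥j0} be a sequence of
nonnegative numbers and let C1 ≥ 1, θ ∈ (0, 1). Assume that for all integers j ≥ j0 + 1 we have
X_j ≤ C1 X_{j−1}^θ X_{j+1}^{1−θ} + C1 B, (15.12) for some B ≥ 0. Then there exists a constant C2 = C2(C1, θ)
such that sup_{j≥j0} X_j ≤ C2 (X_{j0} + B).» The §2 printing (Lemma 2.5 «Barrier» p.11 l.55–59 with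
(2.20)–(2.21): sequences indexed by j ∈ ℤ with summable tails b_j, anchored at large scales by (2.19))
is RECORDED, not typed. Consumed by Theorem 15.8's proof p.64 l.67–76 («We apply Lemma 15.7 with
X_j = M_j defined above and B coming from (15.10)»). [claim: Dahlke2026, status: under-review]
[cite: Dahlke2026, Lemma 15.7 p.64 l.7–20; Lemma 2.5 p.11 l.55–59] -/
def Step_L157 : Prop :=
  ∀ C₁ : ℝ, 1 ≤ C₁ → ∀ θ : ℝ, 0 < θ → θ < 1 →
    ∃ C₂ : ℝ, ∀ (X : ℕ → ℝ) (j₀ : ℕ) (B : ℝ), (∀ j, 0 ≤ X j) → 0 ≤ B →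
      (∀ j : ℕ, j₀ + 1 ≤ j → X j ≤ C₁ * X (j - 1) ^ θ * X (j + 1) ^ (1 - θ) + C₁ * B) →
        ∀ j : ℕ, j₀ ≤ j → X j ≤ C₂ * (X j₀ + B)

/-- **Step E — the finite energy bound of §15.7 p.62 l.68–85** («We … consider suitable weak solutions
(u, p) of (15.1) on ℝ³ × (0, T) with finite energy, sup ∫|u|² + ∫∫|∇u|² ≤ M², for some M > 0»): every
solution of the class carries some energy bound `M`. TRUE-type for finite-energy classical solutions
from Schwartz data (energy equality; tree `TaoFiniteEnergyLerayHopf`); not a candidate locator.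
[claim: Dahlke2026, status: under-review] [cite: Dahlke2026, §15.7 p.62 l.68–85] -/
def Step_Energy : Prop :=
  ∀ T : ℝ, 0 < T → ∀ (u₀ : E3 → E3) (u : ℝ → E3 → E3) (p : ℝ → E3 → ℝ),
    IsDatum u₀ → IsSol T u₀ u p → ∃ M : ℝ, 0 < M ∧ EnergyBound M T u

/-- **Step 15.8 ⇒ 2.7 AS CONSUMED — Theorem 15.8 p.64 l.83–89 («for an arbitrary r ∈ (0, r0] we choose j
with r_{j+1} ≤ r ≤ r_j … this gives K(r, z0) ≤ C(M_j + M_{j+1}) ≤ C(M, T), uniformly in z0»), (2.22)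
p.12 l.13–17 («K_loc(T) = sup_{z0, r² ≤ T} {C(u; r, z0) + D(p; r, z0)} ≲ M_∗»), Proposition 2.6 (c) ⇒ (a)
p.12 l.19–29 and Theorem 2.7 p.13 l.85–94, consumed at p.14 l.56–60** («By Theorem 2.7, for every T > 0
one has u ∈ L∞((0, T); L³(ℝ³))»): along a solution of the class, a bound on the dyadic budget sups of
every region from some index on gives `sup_{t∈[0,T)} ‖u(t)‖_{L³} < ∞`.
[claim: Dahlke2026, status: under-review]
[cite: Dahlke2026, Thm 15.8 p.64 l.58–89; (2.22) p.12 l.13–17; Prop 2.6 p.12 l.19–29; Thm 2.7 p.13 l.85–94; p.14 l.56–60] -/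
def Step_L3_of_dyadic : Prop :=
  ∀ T : ℝ, 0 < T → ∀ (u₀ : E3 → E3) (u : ℝ → E3 → E3) (p : ℝ → E3 → ℝ),
    IsDatum u₀ → IsSol T u₀ u p →
      (∀ zc ∈ slab T, ∃ j₀ : ℕ, ∃ S : ℝ, ∀ j : ℕ, j₀ ≤ j → dyadicSup zc u p j ≤ ENNReal.ofReal S) →
        (⨆ t ∈ Ico 0 T, eLpNorm (u t) 3 volume) < ⊤

/-- **Step 2.7 — Theorem 2.7 (Uniform critical bound from P1) p.13 l.85–94 AS CONSUMED by Thm 3.1's proof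
p.14 l.56–60 and Thm 11.5 p.45 l.25–35** («for every T > 0 one has u ∈ L∞((0, T); L³(ℝ³))»): along
every solution of the class, `sup_{t∈[0,T)} ‖u(t)‖_{L³(ℝ³)} < ∞`. The printed face is STRONGER and
RECORDED here: «There exists a nondecreasing function Φ such that for every T > 0,
‖u‖_{L∞(0,T;L³)} + ‖u‖_{L⁵((0,T)×ℝ³)} + ‖u‖_{L∞(0,T;Ḣ^{1/2})} ≤ Φ(‖u0‖_{L²} + ‖u0‖_{Ḣ^{1/2}})» (uniformity
in the datum, for suitable weak solutions). DERIVED in the kernel from the binders (`thm27_of_steps`).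
[claim: Dahlke2026, status: under-review] [cite: Dahlke2026, Thm 2.7 p.13 l.85–94; p.14 l.56–60] -/
def Step_Thm27 : Prop :=
  ∀ T : ℝ, 0 < T → ∀ (u₀ : E3 → E3) (u : ℝ → E3 → E3) (p : ℝ → E3 → ℝ),
    IsDatum u₀ → IsSol T u₀ u p → (⨆ t ∈ Ico 0 T, eLpNorm (u t) 3 volume) < ⊤

/-- **Step 11.5 — Theorem 11.5 (Exclusion of finite time blow up) p.45 l.25–37**: «Assume P1, i.e.
Theorem 2.7. Then for every T > 0 one has u ∈ L∞((0, T); L³(ℝ³)). By the endpoint Prodi–Serrin criterion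
of Escauriaza–Seregin–Šverák, every suitable weak solution with this property is regular up to time T
and admits continuation beyond T; see [6]. Consequently, no finite blow–up time exists.» Typed as the
implication Theorem 2.7 (as consumed) ⟹ (A) at ν = 1. TRUE — PROVED (`step_Thm115_holds`, the tree's
ESS door). [claim: Dahlke2026, status: under-review] [cite: Dahlke2026, Thm 11.5 p.45 l.25–37]
[cite: EscauriazaSereginSverak2003, Thm. 1.4] -/
def Step_Thm115 : Prop := Step_Thm27 → clayR3.RegularityAt 1

/-! ## Kernel composition and the Clay link -/

/-- **Theorem 11.5 is a theorem of the tree** (the ESS endpoint in Clay form,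
`clayR3_regularityAt_iff_aprioriL3Bound` at μ = 1; slabs with `T ≤ 0` are empty).
[cite: Dahlke2026, Thm 11.5 p.45 l.25–37] [cite: EscauriazaSereginSverak2003, Thm. 1.4] -/
theorem step_Thm115_holds : Step_Thm115 := by
  intro h27
  refine (clayR3_regularityAt_iff_aprioriL3Bound one_pos).2 ?_
  intro u₀ hu₀ hdiv hdec T u p hcl hu0 hA
  rcases le_or_gt T 0 with hT | hT
  · have hempty : Ico (0 : ℝ) T = ∅ := Ico_eq_empty (not_lt.2 hT)
    simp [hempty]
  · exact h27 T hT u₀ u p ⟨hu₀, hdiv, hdec⟩ ⟨hcl, hu0, hA⟩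

/-- **The chain Thm 15.3 ⟹ (15.11) ⟹ [Lemma 15.7] dyadic bound ⟹ [Thm 15.8 / (2.22) / Prop 2.6] Thm 2.7,
composed in the kernel** (pure logic; p.64 l.67–89, p.13 l.75–84): for each region centre, (15.11)
along the solution feeds the abstract Lemma 15.7 with `X_j = M_j` (finite reals from `j0` on), giving
`M_j ≤ C2 (M_{j0} + B)` for all `j ≥ j0`; Step 15.8 ⇒ 2.7 turns the bound into `u ∈ L∞((0,T); L³)`.
[cite: Dahlke2026, Thm 15.8 proof p.64 l.67–89; p.13 l.75–94] -/
theorem thm27_of_steps (h153 : Step_Thm153) (h1511 : Step_1511) (h157 : Step_L157)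
    (hE : Step_Energy) (hL3 : Step_L3_of_dyadic) : Step_Thm27 := by
  intro T hT u₀ u p hd hS
  obtain ⟨M, hM, hEM⟩ := hE T hT u₀ u p hd hS
  refine hL3 T hT u₀ u p hd hS fun zc hzc => ?_
  obtain ⟨C₁, θ, B, j₀, hC₁, hθ0, hθ1, hB, hfin, hineq⟩ :=
    h1511 h153 T hT M hM u₀ u p hd hS hEM zc hzc
  obtain ⟨C₂, hC₂⟩ := h157 C₁ hC₁ θ hθ0 hθ1
  have hb := hC₂ (fun j => (dyadicSup zc u p j).toReal) j₀ B (fun _ => ENNReal.toReal_nonneg) hB hineq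
  refine ⟨j₀, C₂ * ((dyadicSup zc u p j₀).toReal + B), fun j hj => ?_⟩
  rw [← ENNReal.ofReal_toReal (hfin j hj).ne]
  exact ENNReal.ofReal_le_ofReal (hb j hj)

/-- Theorem 2.7 (as consumed) gives the claimed theorem (through Thm 11.5 = the ESS door at ν = 1).
[cite: Dahlke2026, Thm 3.1 proof p.14 l.52–64] -/
theorem claim_of_thm27 (h27 : Step_Thm27) : ClaimedTheorem := by
  intro u₀ hd
  exact step_Thm115_holds h27 u₀ hd.1 hd.2.1 hd.2.2

/-- **COMPOSITION OF THE PRINTED CHAIN (PROVED)**: P1 (Thm 15.3), the implication (15.11), the abstract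
Lemma 15.7, the energy bound of the class and the consumed Thm 15.8 ⇒ Thm 2.7 passage give Theorem 3.1's
core. Binders in dependency order: `h153`, `h1511`, `h157`, `hE`, `hL3`.
[cite: Dahlke2026, p.14 l.14–19; Remark 3.3 p.15 l.64–81; Thm 3.1 proof p.14 l.52–64] -/
theorem claim_of_steps (h153 : Step_Thm153) (h1511 : Step_1511) (h157 : Step_L157)
    (hE : Step_Energy) (hL3 : Step_L3_of_dyadic) : ClaimedTheorem :=
  claim_of_thm27 (thm27_of_steps h153 h1511 h157 hE hL3)

/-- **CLAY LINK (PROVED, both ways)**: the claimed theorem IS Clay (A) — data (4) exactly, ν = 1 ⇔ all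
ν > 0 by the tree's scaling `clayR3_regularityAt_iff`. No «wrong problem» axis.
[cite: FeffermanClay2006, (A) with (4) (6) (7) p. 2] [cite: Dahlke2026, Thm 3.1 p.14 l.34–51] -/
theorem claimedTheorem_iff_clayA : ClaimedTheorem ↔ clayR3.Regularity := by
  rw [← clayR3_regularityAt_iff one_pos]
  constructor
  · intro h u₀ hu₀ hdiv hdec
    exact h u₀ ⟨hu₀, hdiv, hdec⟩
  · intro h u₀ hd
    exact h u₀ hd.1 hd.2.1 hd.2.2

/-- Clay (A) from the claimed theorem. [cite: FeffermanClay2006, (A) p. 2] -/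
theorem clay_of_claimed (h : ClaimedTheorem) : clayR3.Regularity := claimedTheorem_iff_clayA.1 h

/-- Clay (A) from the printed chain. [cite: Dahlke2026, p.14 l.14–19] [cite: FeffermanClay2006, (A) p. 2] -/
theorem clay_of_steps (h153 : Step_Thm153) (h1511 : Step_1511) (h157 : Step_L157)
    (hE : Step_Energy) (hL3 : Step_L3_of_dyadic) : clayR3.Regularity :=
  clay_of_claimed (claim_of_steps h153 h1511 h157 hE hL3)

/-! ## Rev 2 (ADDITIVE — nothing above is touched; REF-3 F-PASS 2026-08-27T14:33:52Z flag F-B, 2-READ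
typist-9 g6 14:30:55Z item (10)): the UNIFORM faces of the passage (15.11) ⇒ Lemma 15.7 ⇒ (15.13) ⇒ Thm 2.7

F-B: `Step_L3_of_dyadic` above takes a PER-CENTRE eventual bound (`∃ j₀ S` inside `∀ z_c`) as
antecedent, whereas the print's (15.13) p.64 l.58–66 / l.89 is UNIFORM («uniformly in z0 ∈ Q1/2»,
`C = C(M,T)`), and the print consumes two further sentences to get there: the ANCHOR p.64 l.77–79
(«M_{j0} can be bounded a priori in terms of the global energy M (for instance using Caccioppoli and
interpolation estimates on a fixed radius)») and the dyadic-to-all-radii passage l.83–88. The faces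
below re-type that passage with the print's quantifier order — constants depending on `(M, T)` only,
chosen BEFORE the solution and the region — and with the region guard the print imposes through
«Q_{4R}(z0) ⊂ ℝ³ × (0, T)» (p.63 l.7–9) transported to the region («a fixed compact space–time region»,
p.63 l.58): `RegionOK`. The uniform chain re-composes in the kernel (`thm27_of_steps_u`,
`claim_of_steps_u`), again consuming the abstract Lemma 15.7 (`Step_L157`) with `X_j = M_j`. -/

/-- The region guard of §15.8 (p.63 l.58 «a fixed compact space–time region», with p.63 l.7–9
«Q_{4R}(z0) ⊂ ℝ³ × (0, T)» for the radii used): every centre `z₀` of the region `Q_{1/2}(z_c)` has its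
cylinder `Q_{4 r_{j₀}}(z₀)` inside the open slab (hence all `Q_{4 r_j}(z₀)`, `j ≥ j₀`).
[cite: Dahlke2026, §15.8 p.63 l.56–63; Thm 15.3 p.63 l.7–9] -/
def RegionOK (T : ℝ) (zc : ℝ × E3) (j₀ : ℕ) : Prop :=
  ∀ z₀ ∈ parabolicCylinder (1 / 2 : ℝ) zc,
    (parabolicCylinder (4 * (2 : ℝ)⁻¹ ^ j₀) z₀ : Set (ℝ × E3)) ⊆ slab T

/-- **(15.11), UNIFORM face** (p.64 l.1–5 with p.63 l.60 «j ≥ j0 large enough so that r_j ≤ r0»): the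
printed implication «Theorem 15.3 implies that there exist constants C1 ≥ 1 and θ ∈ (0, 1) such that for
all j ≥ j0+1, M_j ≤ C1 M_{j−1}^θ M_{j+1}^{1−θ} + C1 B» with `C1, θ, B, j0` depending on `(M, T)` ONLY
(inherited from Thm 15.3 and (15.10)), for every solution of the class with energy bound `M` and every
guarded region. [claim: Dahlke2026, status: under-review] [cite: Dahlke2026, (15.11) p.64 l.1–5; §15.8 p.63 l.56–63] -/
def Step_1511u : Prop :=
  Step_Thm153 →
    ∀ T : ℝ, 0 < T → ∀ M : ℝ, 0 < M →
      ∃ C₁ θ B : ℝ, ∃ j₀ : ℕ, 1 ≤ C₁ ∧ 0 < θ ∧ θ < 1 ∧ 0 ≤ B ∧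
        ∀ (u₀ : E3 → E3) (u : ℝ → E3 → E3) (p : ℝ → E3 → ℝ),
          IsDatum u₀ → IsSol T u₀ u p → EnergyBound M T u →
            ∀ zc ∈ slab T, RegionOK T zc j₀ →
              (∀ j : ℕ, j₀ ≤ j → dyadicSup zc u p j < ⊤) ∧
              ∀ j : ℕ, j₀ + 1 ≤ j →
                (dyadicSup zc u p j).toReal ≤
                  C₁ * (dyadicSup zc u p (j - 1)).toReal ^ θ *
                      (dyadicSup zc u p (j + 1)).toReal ^ (1 - θ) + C₁ * B

/-- **The ANCHOR of Theorem 15.8's proof, p.64 l.77–79**: «Since M_{j0} can be bounded a priori in terms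
of the global energy M (for instance using Caccioppoli and interpolation estimates on a fixed radius)»:
for every fixed dyadic index `j₀` there is `C_A = C_A(M, T, j₀)` with `M_{j₀} ≤ C_A` for every solution
of the class with energy bound `M` and every guarded region. TRUE-type (classical interpolation /
pressure estimates at a fixed radius); a consumed sentence, typed because the uniform chain uses it.
[claim: Dahlke2026, status: under-review] [cite: Dahlke2026, Thm 15.8 proof p.64 l.77–79] -/
def Step_Anchor : Prop :=
  ∀ T : ℝ, 0 < T → ∀ M : ℝ, 0 < M → ∀ j₀ : ℕ, ∃ CA : ℝ, 0 ≤ CA ∧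
    ∀ (u₀ : E3 → E3) (u : ℝ → E3 → E3) (p : ℝ → E3 → ℝ),
      IsDatum u₀ → IsSol T u₀ u p → EnergyBound M T u →
        ∀ zc ∈ slab T, RegionOK T zc j₀ → (dyadicSup zc u p j₀).toReal ≤ CA

/-- **Thm 15.8 l.80–89 + (2.22) + Prop 2.6 (c) ⇒ (a) + Thm 2.7, UNIFORM face, AS CONSUMED p.14
l.56–60**: IF the dyadic budget sups are bounded by a constant `C_d = C_d(M, T)` from `j₀` on, uniformly
over the solutions of the class with energy bound `M` and over the guarded regions («sup_{j≥j0} M_j ≤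
C(M, T)», l.80–82, whence (15.13) «uniformly in z0 ∈ Q1/2», l.83–89), THEN every such solution has
`u ∈ L∞((0,T); L³(ℝ³))` ((2.22) p.12 l.13–17, Prop 2.6 (c) ⇒ (a) p.12 l.19–29, (2.27)/Thm 2.7 p.13
l.75–94). [claim: Dahlke2026, status: under-review]
[cite: Dahlke2026, Thm 15.8 p.64 l.58–89; (2.22) p.12 l.13–17; Prop 2.6 p.12 l.19–29; Thm 2.7 p.13 l.85–94; p.14 l.56–60] -/
def Step_L3_of_dyadicU : Prop :=
  ∀ T : ℝ, 0 < T → ∀ M : ℝ, 0 < M → ∀ j₀ : ℕ, ∀ Cd : ℝ,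
    (∀ (u₀ : E3 → E3) (u : ℝ → E3 → E3) (p : ℝ → E3 → ℝ),
        IsDatum u₀ → IsSol T u₀ u p → EnergyBound M T u →
          ∀ zc ∈ slab T, RegionOK T zc j₀ → ∀ j : ℕ, j₀ ≤ j → dyadicSup zc u p j ≤ ENNReal.ofReal Cd) →
      ∀ (u₀ : E3 → E3) (u : ℝ → E3 → E3) (p : ℝ → E3 → ℝ),
        IsDatum u₀ → IsSol T u₀ u p → EnergyBound M T u →
          (⨆ t ∈ Ico 0 T, eLpNorm (u t) 3 volume) < ⊤

/-- **The UNIFORM chain composed in the kernel**: Thm 15.3 ⟹ (15.11) (uniform) ⟹ [Lemma 15.7 with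
`X_j = M_j`, anchor `M_{j₀} ≤ C_A`] `sup_{j≥j₀} M_j ≤ max(C₂,0)·(C_A + B) =: C_d(M,T)` uniformly ⟹
[Thm 15.8 / (2.22) / Prop 2.6 / Thm 2.7] `u ∈ L∞((0,T); L³)`. Pure logic.
[cite: Dahlke2026, Thm 15.8 proof p.64 l.67–89; p.13 l.75–94] -/
theorem thm27_of_steps_u (h153 : Step_Thm153) (h1511 : Step_1511u) (h157 : Step_L157)
    (hA : Step_Anchor) (hE : Step_Energy) (hL3 : Step_L3_of_dyadicU) : Step_Thm27 := by
  intro T hT u₀ u p hd hS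
  obtain ⟨M, hM, hEM⟩ := hE T hT u₀ u p hd hS
  obtain ⟨C₁, θ, B, j₀, hC₁, hθ0, hθ1, hB, H⟩ := h1511 h153 T hT M hM
  obtain ⟨C₂, hC₂⟩ := h157 C₁ hC₁ θ hθ0 hθ1
  obtain ⟨CA, hCA0, hCA⟩ := hA T hT M hM j₀
  refine hL3 T hT M hM j₀ (max C₂ 0 * (CA + B)) ?_ u₀ u p hd hS hEM
  intro v₀ v q hvd hvS hvE zc hzc hreg j hj
  obtain ⟨hfin, hineq⟩ := H v₀ v q hvd hvS hvE zc hzc hreg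
  have hb := hC₂ (fun i => (dyadicSup zc v q i).toReal) j₀ B (fun _ => ENNReal.toReal_nonneg) hB hineq
  have hanch := hCA v₀ v q hvd hvS hvE zc hzc hreg
  have h1 : (dyadicSup zc v q j).toReal ≤ max C₂ 0 * (CA + B) := by
    have h0 : 0 ≤ (dyadicSup zc v q j₀).toReal + B := add_nonneg ENNReal.toReal_nonneg hB
    calc (dyadicSup zc v q j).toReal ≤ C₂ * ((dyadicSup zc v q j₀).toReal + B) := hb j hj
      _ ≤ max C₂ 0 * ((dyadicSup zc v q j₀).toReal + B) :=
          mul_le_mul_of_nonneg_right (le_max_left _ _) h0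
      _ ≤ max C₂ 0 * (CA + B) :=
          mul_le_mul_of_nonneg_left (by linarith) (le_max_right _ _)
  rw [← ENNReal.ofReal_toReal (hfin j hj).ne]
  exact ENNReal.ofReal_le_ofReal h1

/-- **COMPOSITION OF THE UNIFORM CHAIN (PROVED)** — binders in dependency order `h153` (P1), `h1511`
((15.11) uniform), `h157` (Lemma 15.7, abstract), `hA` (anchor p.64 l.77–79), `hE` (energy bound),
`hL3` (Thm 15.8 / (2.22) / Prop 2.6 / Thm 2.7, uniform). [cite: Dahlke2026, p.14 l.14–19; Thm 3.1 proof p.14 l.52–64] -/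
theorem claim_of_steps_u (h153 : Step_Thm153) (h1511 : Step_1511u) (h157 : Step_L157)
    (hA : Step_Anchor) (hE : Step_Energy) (hL3 : Step_L3_of_dyadicU) : ClaimedTheorem :=
  claim_of_thm27 (thm27_of_steps_u h153 h1511 h157 hA hE hL3)

/-- Clay (A) from the uniform chain. [cite: Dahlke2026, p.14 l.14–19] [cite: FeffermanClay2006, (A) p. 2] -/
theorem clay_of_steps_u (h153 : Step_Thm153) (h1511 : Step_1511u) (h157 : Step_L157)
    (hA : Step_Anchor) (hE : Step_Energy) (hL3 : Step_L3_of_dyadicU) : clayR3.Regularity :=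
  clay_of_claimed (claim_of_steps_u h153 h1511 h157 hA hE hL3)



/-! ## Rev 3 (ADDITIVE — nothing above is touched): Step E is a theorem IN-FILE (D-0026; custodian
typist-6 g6, announce-first 2026-08-27T15:22Z; tool `ClayR3LocalEnergyBridge` §2 «half-open slabs»,
ns-claims-lit-4 g8 p539688). The Summits-side twin `…Theorems.Dahlke2026Salvage.step_Energy_holds`
(ns-claims-salvage-p5 g4, p539201) landed first; this is the Literature-side discharge next to the def. -/

/-- **Step E holds**: every finite-energy classical solution on `[0,T)` (ν = 1) from a Clay datum obeys
the energy budget of §15.7 with `M = √B + 1`, `B = (sup_t ∫|u|² + ∫∫|∇u|²_F) ≤ (1 + ½)∫|u₀|² < ∞` — the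
Leray energy inequality on every closed sub-slab + monotone convergence
(`ClayVariants.energyBudget_le_initial_of_Ico`) and the finite energy of a class-(4) datum
(`HasRapidSpatialDecay.lintegral_enorm_sq_lt_top`). [cite: Dahlke2026, §15.7 p.62 l.68–85]
[cite: Leray1934, (3.4)] [cite: Tao2011, Lemma 8.1] -/
theorem step_Energy_holds : Step_Energy := by
  intro T hT u₀ u p hd hS
  obtain ⟨hcl, hu0, hA⟩ := hS
  have hbud := energyBudget_le_initial_of_Ico one_pos hT hcl hA
  have hfin : (1 + (ENNReal.ofReal (2 * (1 : ℝ)))⁻¹) * ∫⁻ x, ‖u 0 x‖ₑ ^ 2 < ⊤ := by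
    rw [hu0]
    refine ENNReal.mul_lt_top ?_ hd.2.2.lintegral_enorm_sq_lt_top
    have h2 : (ENNReal.ofReal (2 * (1 : ℝ)))⁻¹ < ⊤ :=
      ENNReal.inv_lt_top.2 (ENNReal.ofReal_pos.2 (by norm_num))
    exact ENNReal.add_lt_top.2 ⟨ENNReal.one_lt_top, h2⟩
  set Bud : ℝ≥0∞ := (⨆ t ∈ Ioo 0 T, ∫⁻ x, ‖u t x‖ₑ ^ 2) +
      ∫⁻ q in Ioo 0 T ×ˢ (univ : Set E3), ENNReal.ofReal (frobeniusNormSq (fderiv ℝ (u q.1) q.2))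
    with hBud_def
  have hBud : Bud < ⊤ := lt_of_le_of_lt hbud hfin
  refine ⟨Real.sqrt Bud.toReal + 1, by positivity, ?_⟩
  show Bud ≤ ENNReal.ofReal ((Real.sqrt Bud.toReal + 1) ^ 2)
  refine (ENNReal.le_ofReal_iff_toReal_le hBud.ne (by positivity)).2 ?_
  have hx : 0 ≤ Bud.toReal := ENNReal.toReal_nonneg
  have hs := Real.sq_sqrt hx
  nlinarith [Real.sqrt_nonneg Bud.toReal]

/-- `Step_Energy` — `_holds` alias of `step_Energy_holds` above under the fact's exact name (appended
2026-08-28, D-0026 bookkeeping: the proof term is the existing theorem of this file; no statement,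
definition or attribute is edited; no new named fact; the ledger's debt table listed the fact
unproved). [cite: Tao2011, Lemma 8.1] -/
theorem _root_.Literature.Claims.NS.Dahlke2026.Step_Energy_holds : Step_Energy :=
  _root_.Literature.Claims.NS.Dahlke2026.step_Energy_holds

/-- With Step E discharged in-file: the chain from P1, (15.11), Lemma 15.7 and the consumed
Thm 15.8 ⇒ 2.7 passage alone. [cite: Dahlke2026, p.14 l.14–19] -/
theorem claim_of_steps' (h153 : Step_Thm153) (h1511 : Step_1511) (h157 : Step_L157)
    (hL3 : Step_L3_of_dyadic) : ClaimedTheorem :=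
  claim_of_steps h153 h1511 h157 step_Energy_holds hL3

/-- Uniform chain with Step E discharged in-file. [cite: Dahlke2026, p.14 l.14–19] -/
theorem claim_of_steps_u' (h153 : Step_Thm153) (h1511 : Step_1511u) (h157 : Step_L157)
    (hA : Step_Anchor) (hL3 : Step_L3_of_dyadicU) : ClaimedTheorem :=
  claim_of_steps_u h153 h1511 h157 hA step_Energy_holds hL3

end

end Literature.Claims.NS.Dahlke2026

-- WHAT THIS IS NOT: not a claim about NS regularity or blow-up; not a claim about any author beyond the
-- typed locator.
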